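import Literature.NumberTheory.Sieve.HeathBrownCubicApproxS4
import HarnessLib

/-!
# Heath-Brown's Lemma 3.7 from Lemma 7.1, II: the generic `U`-approximation inequality

Pure-proof file (no definitions) in the deduction of **Lemma 3.7 from the corrected Lemma 7.1** of
D. R. Heath-Brown, *Primes represented by `x³ + 2y³`*, Acta Math. 186 (2001), 1–84, §7 pp. 42–47
(decomposition of **parity.S18**, `Literature.NumberTheory.Sieve.setOf_prime_cube_add_two_mul_cube_infinite`).
The pieces `U₁^(1)`, `U₁^(2)` and `U^(n)` (`n ≥ 3`) of (3.1)/p. 13 are sums, over chain indices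
`({P_1,…,P_n}, P_{n+1})` (`Upairs`), of `S_K^≺(𝒵_{P_1⋯P_{n+1}}, P_{n+1})`; their approximations
`Û^(n) = ∑_𝐦 Û^{(𝐦,n)}` (`Uhat`, p. 15) are bilinear sums over admissible vectors `𝐦` and prime
tuples `P_i ∈ 𝒥(m_i)`. This file proves the family-independent comparison of the two, in the raw
form from which the `𝒜`- and `ℬ`-estimates are then derived:

* Part A — admissible tuples give chain indices: `U_index_props` (the constraints of p. 15 unpacked),
  `image_castSucc_props`, `toPair_mem` (`(𝐦,(P_i)) ↦ ({P_1,…,P_n}, P_{n+1}) ∈ Upairs n` with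
  `X^{1+τ} ≤ N(P_1⋯P_{n+1}) < X^{3/2−τ}`), `toPair_injOn`, `isRough_prod_of_le`.
* Part B — **sorted tuples**: `exists_preimage_of_good` constructs, from a good chain index (all
  norms prime and distinct) avoiding the six edge/close patterns of p. 43, the admissible tuple it
  comes from (enumerate the primes by decreasing norm with `Finset.orderEmbOfFin`, take `m_i` with
  `P_i ∈ 𝒥(m_i)`, and read the constraints of p. 15 off the avoided patterns); its contrapositive
  `unmatched_good_cases` classifies the unmatched good indices: (a) a norm `< X^{τ+ξ}`, (b) a norm
  `≥ X^{1−τ−ξ}`, (c) `N(P_1⋯P_n) > X^{1+τ−nξ}`, (d) `N(P_1⋯P_{n+1}) < X^{1+τ+(n+1)ξ}`, (e) two norms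
  with `N < N' < N·X^ξ`, (f) `N(P_1⋯P_{n+1}) > X^{3/2−τ−(n+1)ξ}` ("the net effect of these estimates
  is that we may restrict the prime ideals `P_i` so that `N(P_i) ∈ J(m_i)`", p. 43).
* Part C — `U1piece_eq_sum`, `Uhat_eq_sum`, **`U_abs_sub_le`**: `|U₁^(n) − Û^(n)| ≤` (E1) family
  counts over the non-good indices + (E2) `S_K(·, X^τ)` over the unmatched good indices + (E3) the
  Buchstab range + (E4) the square-free defect + (E5) `((1+1/μ)^{n+1} − 1)·∑ S_K(𝒵_{∏P}, X^τ)`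
  (weight), via `abs_sub_le_of_matching`; `sum_unmatched_good_le` ((E2) over the six classes).

## References

* D. R. Heath-Brown, *Primes represented by `x³ + 2y³`*, Acta Math. 186 (2001), 1–84: §3 p. 15
  (`Û^{(𝐦,n)}`), §7 pp. 42–45. [cite: HeathBrownActa2001, §7 pp. 42–45]
* G. Harman, *Prime-Detecting Sieves*, LMS Monographs 33, Princeton (2007), §13.2. [cite: Harman2007, §13.2]

## Mathlib / tree search

Mathlib: `Finset.orderEmbOfFin`, `Finset.orderEmbOfFin_mem`, `Finset.orderEmbOfFin_zero`,
`Finset.choose`/`choose_mem`/`choose_property`, `Fin.rev_lt_rev`, `Fin.rev_last`,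
`Fin.prod_univ_castSucc`, `Finset.prod_image`, `Finset.eq_of_subset_of_card_le`, `Finset.sum_sigma`,
`Finset.sum_filter`. Tree: `HeathBrownCubicHatCore`, `HeathBrownCubicApproxS4`,
`HeathBrownCubicUpperBoundTools` (`uIdeal`, `UGood`, `mem_Upairs_iff`, `mem_chains_iff`,
`mem_smallPrimes_iff`, `snd_notMem_fst`, `UpieceWhere_eq`, `famSiftedAbove_le_famCount`),
`HeathBrownCubicTypeII` (`Uhat`, `UhatPiece`, `mIndexU`, `mem_mIndexU_iff`, `UAdmissible`,
`rpow_sum_eq_prod_lower/upper`, `prod_rpow_eq_rpow_sum`), `HeathBrownCubicSieveDecomposition`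
(`U1piece`, `Upairs`, `PrimeLT`, `primeLT_of_absNorm_lt`).
-/

noncomputable section

open Polynomial NumberField Finset Filter Topology Asymptotics
open scoped nonZeroDivisors

namespace Literature.NumberTheory.Sieve.CubicSieve

open LFunctions.CubeRootTwoField CubicPrimes
open Literature.NumberTheory.LFunctions (idealNormCount)

/-! ### Admissible tuples of `Û^{(n)}` and the chain index `({P_1,…,P_n}, P_{n+1})` they define -/

section TupleToPair

variable {X τ : ℝ} {n : ℕ}

/-- Unpacking the hat index of `Û^(n)`: `𝐦` satisfies the constraints of p. 15 and `P_i ∈ 𝒥(m_i)`;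
consequences used below. [cite: HeathBrownActa2001, §3 p. 15] -/
theorem U_index_props (hX : 1 < X) (hτ : 0 < τ) (hτ1 : τ ≤ 1)
    {m : Fin (n + 1) → ℕ} (hm : m ∈ mIndexU τ n) {P : Fin (n + 1) → Ideal (𝓞 K)}
    (hP : P ∈ Fintype.piFinset fun i => Jprimes X τ (m i)) :
    UAdmissible τ m ∧
    (∀ j, (P j).IsPrime ∧ P j ≠ ⊥ ∧ (Ideal.absNorm (P j)).Prime ∧
      X ^ ((m j : ℝ) * hbXi τ) ≤ (Ideal.absNorm (P j) : ℝ) ∧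
      (Ideal.absNorm (P j) : ℝ) < X ^ (((m j : ℝ) + 1) * hbXi τ)) ∧
    (∀ j, P j ∈ smallPrimes X τ) ∧
    (StrictAnti fun j => Ideal.absNorm (P j)) ∧
    (∀ j, X ^ ((m (Fin.last n) : ℝ) * hbXi τ) ≤ (Ideal.absNorm (P j) : ℝ)) ∧
    X ^ (1 + τ) ≤ ∏ j, (Ideal.absNorm (P j) : ℝ) ∧
    ∏ j, (Ideal.absNorm (P j) : ℝ) < X ^ (3 / 2 - τ) ∧
    ∏ i : Fin n, (Ideal.absNorm (P (Fin.castSucc i)) : ℝ) < X ^ (1 + τ) ∧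
    (∀ j, 1 ≤ m j) ∧ X ^ τ ≤ X ^ ((m (Fin.last n) : ℝ) * hbXi τ) := by
  have hξ := hbXi_pos hτ
  have hX0 : 0 < X := by linarith
  have hadm : UAdmissible τ m := (mem_mIndexU_iff hτ).mp hm
  obtain ⟨⟨hanti, h5, h6, h7⟩, h15, h16⟩ := (mem_mIndexU_iff hτ).mp hm
  have hJ := fun j => (mem_Jprimes_iff X τ).mp (Fintype.mem_piFinset.mp hP j)
  have hSA : StrictAnti fun j => Ideal.absNorm (P j) := strictAnti_absNorm_of_mem_piFinset hX hτ hanti hP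
  -- exponent facts
  have hτm : ∀ j, τ ≤ (m j : ℝ) * hbXi τ := fun j => by
    have := h5 j; rwa [div_le_iff₀ hξ] at this
  have hm0 : ∀ j, ((m j : ℝ) + 1) * hbXi τ ≤ 1 - τ := fun j => by
    have hj0 : m j ≤ m 0 := hanti.antitone (Fin.zero_le j)
    have h1 : ((m j : ℝ) + 1) ≤ (m 0 : ℝ) + 1 := by exact_mod_cast Nat.add_le_add_right hj0 1
    have h2 : ((m 0 : ℝ) + 1) * hbXi τ ≤ 1 - τ := by rwa [le_div_iff₀ hξ] at h16
    nlinarith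
  have hm1 : ∀ j, 1 ≤ m j := fun j => by
    have h1 : (1 : ℝ) ≤ τ / hbXi τ := by
      rw [le_div_iff₀ hξ, one_mul]; exact hbXi_le hτ.le hτ1
    exact_mod_cast h1.trans (h5 j)
  have hsmall : ∀ j, P j ∈ smallPrimes X τ := fun j => by
    obtain ⟨hp, hp0, hlo, hhi, -⟩ := hJ j
    refine mem_smallPrimes_iff.mpr ⟨hp, hp0, ?_, ?_⟩
    · exact (Real.rpow_le_rpow_of_exponent_le hX.le (hτm j)).trans hlo
    · exact hhi.trans_le (Real.rpow_le_rpow_of_exponent_le hX.le (hm0 j))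
  have hlast : ∀ j, X ^ ((m (Fin.last n) : ℝ) * hbXi τ) ≤ (Ideal.absNorm (P j) : ℝ) := fun j => by
    have hj : m (Fin.last n) ≤ m j := hanti.antitone (Fin.le_last j)
    have h1 : (m (Fin.last n) : ℝ) * hbXi τ ≤ (m j : ℝ) * hbXi τ :=
      mul_le_mul_of_nonneg_right (by exact_mod_cast hj) hξ.le
    exact (Real.rpow_le_rpow_of_exponent_le hX.le h1).trans (hJ j).2.2.1
  -- products
  have hlow : X ^ (1 + τ) ≤ ∏ j, (Ideal.absNorm (P j) : ℝ) := by
    calc X ^ (1 + τ) ≤ X ^ (hbXi τ * ∑ j, (m j : ℝ)) := by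
          refine Real.rpow_le_rpow_of_exponent_le hX.le ?_
          rw [div_le_iff₀ hξ] at h6; linarith
      _ = ∏ j, X ^ ((m j : ℝ) * hbXi τ) := rpow_sum_eq_prod_lower hX0 m
      _ ≤ ∏ j, (Ideal.absNorm (P j) : ℝ) :=
          prod_le_prod (fun j _ => Real.rpow_nonneg hX0.le _) fun j _ => (hJ j).2.2.1
  have hup : ∏ j, (Ideal.absNorm (P j) : ℝ) < X ^ (3 / 2 - τ) := by
    calc ∏ j, (Ideal.absNorm (P j) : ℝ) < ∏ j, X ^ (((m j : ℝ) + 1) * hbXi τ) :=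
          prod_lt_prod_of_nonempty (fun j _ => lt_of_lt_of_le (Real.rpow_pos_of_pos hX0 _) (hJ j).2.2.1)
            (fun j _ => (hJ j).2.2.2.1) univ_nonempty
      _ = X ^ (hbXi τ * ∑ j, ((m j : ℝ) + 1)) := (rpow_sum_eq_prod_upper hX0 m).symm
      _ ≤ X ^ (3 / 2 - τ) := by
          refine Real.rpow_le_rpow_of_exponent_le hX.le ?_
          rw [le_div_iff₀ hξ] at h7; linarith
  have hchain : ∏ i : Fin n, (Ideal.absNorm (P (Fin.castSucc i)) : ℝ) < X ^ (1 + τ) := by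
    rcases Nat.eq_zero_or_pos n with hn | hn
    · subst hn
      simp only [univ_eq_empty, prod_empty]
      exact Real.one_lt_rpow hX (by linarith)
    · haveI : Nonempty (Fin n) := ⟨⟨0, hn⟩⟩
      calc ∏ i : Fin n, (Ideal.absNorm (P (Fin.castSucc i)) : ℝ)
          < ∏ i : Fin n, X ^ (((m (Fin.castSucc i) : ℝ) + 1) * hbXi τ) :=
            prod_lt_prod_of_nonempty
              (fun i _ => lt_of_lt_of_le (Real.rpow_pos_of_pos hX0 _) (hJ _).2.2.1)
              (fun i _ => (hJ _).2.2.2.1) univ_nonempty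
        _ = X ^ (∑ i : Fin n, ((m (Fin.castSucc i) : ℝ) + 1) * hbXi τ) := prod_rpow_eq_rpow_sum hX0 _
        _ ≤ X ^ (1 + τ) := by
            refine Real.rpow_le_rpow_of_exponent_le hX.le ?_
            rw [← sum_mul]
            rw [le_div_iff₀ hξ] at h15
            exact h15
  exact ⟨hadm, fun j => ⟨(hJ j).1, (hJ j).2.1, (hJ j).2.2.2.2, (hJ j).2.2.1, (hJ j).2.2.2.1⟩, hsmall, hSA,
    hlast, hlow, hup, hchain, hm1, Real.rpow_le_rpow_of_exponent_le hX.le (hτm _)⟩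

/-- The chain part `{P_1, …, P_n}` of an admissible tuple: product, cardinality. [folklore] -/
theorem image_castSucc_props {P : Fin (n + 1) → Ideal (𝓞 K)}
    (hSA : StrictAnti fun j => Ideal.absNorm (P j)) :
    ∏ Q ∈ (univ : Finset (Fin n)).image (fun i => P (Fin.castSucc i)), Q = ∏ i : Fin n, P (Fin.castSucc i) ∧
    #((univ : Finset (Fin n)).image (fun i => P (Fin.castSucc i))) = n ∧
    P (Fin.last n) ∉ (univ : Finset (Fin n)).image (fun i => P (Fin.castSucc i)) ∧
    (∏ Q ∈ (univ : Finset (Fin n)).image (fun i => P (Fin.castSucc i)), Q) * P (Fin.last n) = ∏ j, P j := by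
  classical
  have hinjP : Function.Injective P := fun i j h => hSA.injective (by simp [h])
  have hinj : Function.Injective fun i : Fin n => P (Fin.castSucc i) :=
    hinjP.comp (Fin.castSucc_injective n)
  have h1 : ∏ Q ∈ (univ : Finset (Fin n)).image (fun i => P (Fin.castSucc i)), Q =
      ∏ i : Fin n, P (Fin.castSucc i) := prod_image fun i _ j _ h => hinj h
  refine ⟨h1, ?_, ?_, ?_⟩
  · rw [card_image_of_injective _ hinj, card_univ, Fintype.card_fin]
  · intro h
    obtain ⟨i, -, hi⟩ := mem_image.mp h
    exact (Fin.castSucc_lt_last i).ne (hinjP hi)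
  · rw [h1, Fin.prod_univ_castSucc]

/-- **Admissible tuples give chain indices of `U^(n)` in the range of `U₁^(n)`**: for `𝐦` as on
p. 15 and `P_i ∈ 𝒥(m_i)`, `({P_1,…,P_n}, P_{n+1}) ∈ Upairs n` and `N(P_1⋯P_{n+1}) < X^{3/2−τ}`
(`X > 1`, `0 < τ ≤ 1`) — the constraints of p. 15 are the interval forms of the chain conditions.
[cite: HeathBrownActa2001, §3 p. 15] -/
theorem toPair_mem (hX : 1 < X) (hτ : 0 < τ) (hτ1 : τ ≤ 1)
    {m : Fin (n + 1) → ℕ} (hm : m ∈ mIndexU τ n) {P : Fin (n + 1) → Ideal (𝓞 K)}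
    (hP : P ∈ Fintype.piFinset fun i => Jprimes X τ (m i)) :
    ((univ : Finset (Fin n)).image (fun i => P (Fin.castSucc i)), P (Fin.last n)) ∈ Upairs X τ n ∧
    uIdeal ((univ : Finset (Fin n)).image (fun i => P (Fin.castSucc i)), P (Fin.last n)) = ∏ j, P j ∧
    (Ideal.absNorm (∏ j, P j) : ℝ) < X ^ (3 / 2 - τ) ∧
    X ^ (1 + τ) ≤ (Ideal.absNorm (∏ j, P j) : ℝ) := by
  classical
  obtain ⟨-, hJ, hsmall, hSA, -, hlow, hup, hchain, -⟩ := U_index_props hX hτ hτ1 hm hP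
  obtain ⟨hprod, hcard, -, hu⟩ := image_castSucc_props hSA
  have hNprod : (Ideal.absNorm (∏ j, P j) : ℝ) = ∏ j, (Ideal.absNorm (P j) : ℝ) := by
    rw [map_prod, Nat.cast_prod]
  refine ⟨mem_Upairs_iff.mpr ⟨?_, hsmall _, ?_, ?_⟩, by rw [uIdeal, hu], by rw [hNprod]; exact hup,
    by rw [hNprod]; exact hlow⟩
  · refine mem_chains_iff.mpr ⟨?_, hcard, ?_⟩
    · intro Q hQ
      obtain ⟨i, -, rfl⟩ := mem_image.mp hQ
      exact hsmall _
    · rw [hprod, map_prod]; push_cast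
      exact hchain
  · intro Q hQ
    obtain ⟨i, -, rfl⟩ := mem_image.mp hQ
    exact primeLT_of_absNorm_lt (hSA (Fin.castSucc_lt_last i))
  · rw [← map_mul, hu, hNprod]; exact hlow

/-- The map `(𝐦, (P_i)) ↦ ({P_1,…,P_n}, P_{n+1})` is injective on the hat index set of `Û^(n)`
(the ideal `P_1⋯P_{n+1}` determines the tuple, `tuple_eq_of_prod_eq`). [cite: HeathBrownActa2001, §3 (3.5)] -/
theorem toPair_injOn (hX : 1 < X) (hτ : 0 < τ) (hτ1 : τ ≤ 1) :
    Set.InjOn (fun b : (Σ _ : Fin (n + 1) → ℕ, Fin (n + 1) → Ideal (𝓞 K)) =>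
        ((univ : Finset (Fin n)).image (fun i => b.2 (Fin.castSucc i)), b.2 (Fin.last n)))
      ((mIndexU τ n).sigma fun m => Fintype.piFinset fun i => Jprimes X τ (m i) : Set _) := by
  classical
  rintro ⟨m, P⟩ hb ⟨m', P'⟩ hb' h
  simp only [mem_coe, mem_sigma] at hb hb'
  have h1 := (toPair_mem hX hτ hτ1 hb.1 hb.2).2.1
  have h2 := (toPair_mem hX hτ hτ1 hb'.1 hb'.2).2.1
  have hprod : ∏ j, P j = ∏ j, P' j := by
    rw [← h1, ← h2]
    exact congrArg uIdeal h
  have hanti := ((mem_mIndexU_iff hτ).mp hb.1).1.1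
  have hanti' := ((mem_mIndexU_iff hτ).mp hb'.1).1.1
  obtain ⟨hPP, hmm⟩ := tuple_eq_of_prod_eq hX hτ hanti hanti' hb.2 hb'.2 hprod
  subst hPP; subst hmm; rfl

/-- A product of prime ideals each of norm `≥ z` is `z`-rough. [folklore] -/
theorem isRough_prod_of_le {k : ℕ} {P : Fin k → Ideal (𝓞 K)} {z : ℝ}
    (hP : ∀ j, (P j).IsPrime ∧ P j ≠ ⊥) (hz : ∀ j, z ≤ (Ideal.absNorm (P j) : ℝ)) :
    IsRough z (∏ j, P j) := by
  intro Q hQ hQd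
  have hQp : Q ≠ ⊥ := by
    rintro rfl
    have h1 : (0 : Ideal (𝓞 K)) ∣ ∏ j, P j := by rwa [Ideal.zero_eq_bot]
    have h0 : (∏ j, P j) = 0 := zero_dvd_iff.mp h1
    rw [Finset.prod_eq_zero_iff] at h0
    obtain ⟨j, -, hj⟩ := h0
    exact (hP j).2 (by rwa [Ideal.zero_eq_bot] at hj)
  have hpr : Prime Q := Ideal.prime_of_isPrime hQp hQ
  obtain ⟨j, -, hj⟩ := hpr.exists_mem_finset_dvd hQd
  have : Q = P j := (((hP j).1.isMaximal (hP j).2).eq_of_le hQ.ne_top (Ideal.le_of_dvd hj)).symm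
  rw [this]; exact hz j

end TupleToPair

end Literature.NumberTheory.Sieve.CubicSieve

end


/-! ## Part B: sorted tuples and the classification of unmatched good indices -/

noncomputable section

open Polynomial NumberField Finset Filter Topology Asymptotics
open scoped nonZeroDivisors

namespace Literature.NumberTheory.Sieve.CubicSieve

open LFunctions.CubeRootTwoField CubicPrimes
open Literature.NumberTheory.LFunctions (idealNormCount)

section SortedTuple

variable {X τ : ℝ} {n : ℕ}

/-- **A good chain index away from the edge/close patterns is matched.** Let `t = (s, P_{n+1})` be an
index of `U^(n)` all of whose primes have prime, pairwise distinct norms, with (na) every norm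
`≥ X^{τ+ξ}`, (nb) every norm `< X^{1−τ−ξ}`, (nc) `N(P_1⋯P_n) ≤ X^{1+τ−nξ}`, (nd)
`N(P_1⋯P_{n+1}) ≥ X^{1+τ+(n+1)ξ}`, (ne) any two norms `N < N'` satisfy `N·X^ξ ≤ N'`, (nf)
`N(P_1⋯P_{n+1}) ≤ X^{3/2−τ−(n+1)ξ}`. Then, enumerating `{P_1,…,P_{n+1}}` by decreasing norm and
letting `m_i` be the index with `P_i ∈ 𝒥(m_i)`, the vector `𝐦` satisfies the constraints of p. 15
and `t` is the chain index of the admissible tuple `(𝐦, (P_i))` (p. 43: "the net effect of these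
estimates is that we may restrict the prime ideals `P_i` so that `N(P_i) ∈ J(m_i)`, with integers
`m_i` satisfying (3.5), (3.6) and the other relevant conditions"). [cite: HeathBrownActa2001, §7 p. 43] -/
theorem exists_preimage_of_good (hX : 1 < X) (hτ : 0 < τ)
    {t : Finset (Ideal (𝓞 K)) × Ideal (𝓞 K)} (ht : t ∈ Upairs X τ n) (hg : UGood t)
    (na : ∀ Q ∈ insert t.2 t.1, X ^ (τ + hbXi τ) ≤ (Ideal.absNorm Q : ℝ))
    (nb : ∀ Q ∈ insert t.2 t.1, (Ideal.absNorm Q : ℝ) < X ^ (1 - τ - hbXi τ))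
    (nc : (Ideal.absNorm (∏ P ∈ t.1, P) : ℝ) ≤ X ^ (1 + τ - n * hbXi τ))
    (nd : X ^ (1 + τ + (n + 1) * hbXi τ) ≤ (Ideal.absNorm (uIdeal t) : ℝ))
    (ne : ∀ Q ∈ insert t.2 t.1, ∀ Q' ∈ insert t.2 t.1,
      Ideal.absNorm Q < Ideal.absNorm Q' → (Ideal.absNorm Q : ℝ) * X ^ hbXi τ ≤ Ideal.absNorm Q')
    (nf : (Ideal.absNorm (uIdeal t) : ℝ) ≤ X ^ (3 / 2 - τ - (n + 1) * hbXi τ)) :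
    ∃ b ∈ (mIndexU τ n).sigma (fun m => Fintype.piFinset fun i => Jprimes X τ (m i)),
      ((univ : Finset (Fin n)).image (fun i => b.2 (Fin.castSucc i)), b.2 (Fin.last n)) = t := by
  classical
  have hξ := hbXi_pos hτ
  have hX0 : 0 < X := by linarith
  have hmem := mem_Upairs_iff.mp ht
  have hnot := snd_notMem_fst ht
  set s' := insert t.2 t.1 with hs'
  have hprimes : ∀ Q ∈ s', Q.IsPrime ∧ Q ≠ ⊥ := by
    intro Q hQ
    rcases mem_insert.mp hQ with rfl | hQ
    · exact ⟨(mem_smallPrimes_iff.mp hmem.2.1).1, (mem_smallPrimes_iff.mp hmem.2.1).2.1⟩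
    · have h' := mem_smallPrimes_iff.mp ((mem_chains_iff.mp hmem.1).1 hQ)
      exact ⟨h'.1, h'.2.1⟩
  have hcard1 : #t.1 = n := (mem_chains_iff.mp hmem.1).2.1
  have hcards' : #s' = n + 1 := by rw [hs', card_insert_of_notMem hnot, hcard1]
  set σ := s'.image Ideal.absNorm with hσ
  have hσcard : #σ = n + 1 := by rw [hσ, card_image_of_injOn hg.2, hcards']
  -- the decreasing enumeration of the norms and of the primes
  set e := σ.orderEmbOfFin hσcard with he
  set v : Fin (n + 1) → ℕ := fun j => e (Fin.rev j) with hv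
  have hvmem : ∀ j, v j ∈ σ := fun j => Finset.orderEmbOfFin_mem σ hσcard _
  have hvanti : StrictAnti v := fun i j hij => e.strictMono (Fin.rev_lt_rev.mpr hij)
  have hexu : ∀ j, ∃! Q, Q ∈ s' ∧ Ideal.absNorm Q = v j := by
    intro j
    obtain ⟨Q, hQ, hQv⟩ := mem_image.mp (hvmem j)
    exact ⟨Q, ⟨hQ, hQv⟩, fun Q' hQ' => hg.2 hQ'.1 hQ (hQ'.2.trans hQv.symm)⟩
  set P : Fin (n + 1) → Ideal (𝓞 K) := fun j => s'.choose (fun Q => Ideal.absNorm Q = v j) (hexu j)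
    with hPdef
  have hPmem : ∀ j, P j ∈ s' := fun j => choose_mem _ _ (hexu j)
  have hPN : ∀ j, Ideal.absNorm (P j) = v j := fun j => choose_property _ _ (hexu j)
  have hSA : StrictAnti fun j => Ideal.absNorm (P j) := by
    intro i j hij; simp only [hPN]; exact hvanti hij
  have hPinj : Function.Injective P := fun i j h => hSA.injective (by simp [h])
  -- `P_{n+1} = t.2`
  have hmin : ∀ Q ∈ s', Ideal.absNorm t.2 ≤ Ideal.absNorm Q := by
    intro Q hQ
    rcases mem_insert.mp hQ with rfl | hQ
    · exact le_rfl
    · exact (hmem.2.2.1 Q hQ).absNorm_le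
  have hne0 : 0 < n + 1 := Nat.succ_pos n
  have hσne : σ.Nonempty := card_pos.mp (by rw [hσcard]; exact hne0)
  have hv_last : v (Fin.last n) = σ.min' hσne := by
    have h0 : (Fin.rev (Fin.last n) : Fin (n + 1)) = ⟨0, hne0⟩ := by
      rw [Fin.rev_last]; exact Fin.ext (by simp)
    simp only [hv, h0]
    exact Finset.orderEmbOfFin_zero hσcard hne0
  have hmin' : σ.min' hσne = Ideal.absNorm t.2 := by
    refine le_antisymm (min'_le _ _ (mem_image_of_mem _ (mem_insert_self _ _))) ?_
    refine le_min' _ _ _ fun w hw => ?_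
    obtain ⟨Q, hQ, rfl⟩ := mem_image.mp hw
    exact hmin Q hQ
  have hPlast : P (Fin.last n) = t.2 :=
    hg.2 (hPmem _) (mem_insert_self _ _) (by rw [hPN, hv_last, hmin'])
  -- the chain part
  have himage : (univ : Finset (Fin n)).image (fun i => P (Fin.castSucc i)) = t.1 := by
    refine eq_of_subset_of_card_le (fun Q hQ => ?_) ?_
    · obtain ⟨i, -, rfl⟩ := mem_image.mp hQ
      have h1 := hPmem (Fin.castSucc i)
      rcases mem_insert.mp h1 with h2 | h2
      · exfalso
        have : P (Fin.castSucc i) = P (Fin.last n) := by rw [h2, hPlast]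
        exact (Fin.castSucc_lt_last i).ne (hPinj this)
      · exact h2
    · rw [hcard1, (image_castSucc_props hSA).2.1]
  -- the box indices
  have hJex : ∀ j, ∃ mj : ℕ, P j ∈ Jprimes X τ mj := fun j =>
    exists_mem_Jprimes hX hτ (hprimes _ (hPmem j)).1 (hprimes _ (hPmem j)).2 (hg.1 _ (hPmem j))
  choose m hm using hJex
  have hJ := fun j => (mem_Jprimes_iff X τ).mp (hm j)
  -- norms of the products
  obtain ⟨hprod, hcardim, hnotin, hu⟩ := image_castSucc_props hSA
  have huIdeal : uIdeal t = ∏ j, P j := by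
    rw [uIdeal, ← himage, ← hPlast, hu]
  have hNall : (Ideal.absNorm (uIdeal t) : ℝ) = ∏ j, (Ideal.absNorm (P j) : ℝ) := by
    rw [huIdeal, map_prod, Nat.cast_prod]
  have hNchain : (Ideal.absNorm (∏ Q ∈ t.1, Q) : ℝ) = ∏ i : Fin n, (Ideal.absNorm (P (Fin.castSucc i)) : ℝ) := by
    rw [← himage, hprod, map_prod, Nat.cast_prod]
  have hlowP : ∀ j, X ^ ((m j : ℝ) * hbXi τ) ≤ (Ideal.absNorm (P j) : ℝ) := fun j => (hJ j).2.2.1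
  have hhighP : ∀ j, (Ideal.absNorm (P j) : ℝ) < X ^ (((m j : ℝ) + 1) * hbXi τ) := fun j => (hJ j).2.2.2.1
  -- (3.5): `𝐦` strictly decreasing, via (ne)
  have hanti : StrictAnti m := by
    intro i j hij
    have hNij : Ideal.absNorm (P j) < Ideal.absNorm (P i) := hSA hij
    by_contra hle
    push Not at hle
    rcases hle.lt_or_eq with hlt | heq
    · -- `m i < m j`: the intervals are ordered the wrong way
      have h1 : ((m i : ℝ) + 1) * hbXi τ ≤ (m j : ℝ) * hbXi τ := by
        refine mul_le_mul_of_nonneg_right ?_ hξ.le; exact_mod_cast Nat.succ_le_of_lt hlt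
      have h2 := Real.rpow_le_rpow_of_exponent_le hX.le h1
      have h3 : (Ideal.absNorm (P i) : ℝ) < Ideal.absNorm (P j) :=
        (hhighP i).trans_le (h2.trans (hlowP j))
      have h4 : (Ideal.absNorm (P j) : ℝ) < Ideal.absNorm (P i) := by exact_mod_cast hNij
      linarith
    · -- `m i = m j`: a close pair
      have hclose := ne (P j) (hPmem j) (P i) (hPmem i) hNij
      have h1 : X ^ (((m i : ℝ) + 1) * hbXi τ) = X ^ ((m j : ℝ) * hbXi τ) * X ^ hbXi τ := by
        rw [← Real.rpow_add hX0, heq]; ring_nf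
      have h2 : (Ideal.absNorm (P i) : ℝ) < Ideal.absNorm (P j) * X ^ hbXi τ := by
        calc (Ideal.absNorm (P i) : ℝ) < X ^ (((m i : ℝ) + 1) * hbXi τ) := hhighP i
          _ = X ^ ((m j : ℝ) * hbXi τ) * X ^ hbXi τ := h1
          _ ≤ Ideal.absNorm (P j) * X ^ hbXi τ :=
              mul_le_mul_of_nonneg_right (hlowP j) (Real.rpow_nonneg hX0.le _)
      linarith
  -- (3.5) lower bound `m_j ≥ τ ξ^{-1}`, via (na)
  have h5 : ∀ j, τ / hbXi τ ≤ (m j : ℝ) := by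
    intro j
    by_contra hlt
    push Not at hlt
    have h1 : ((m j : ℝ) + 1) * hbXi τ < τ + hbXi τ := by
      rw [lt_div_iff₀ hξ] at hlt; nlinarith
    have h2 := Real.rpow_lt_rpow_of_exponent_lt hX h1
    have h3 := na (P j) (hPmem j)
    linarith [hhighP j]
  -- (3.6) via (nd)
  have h6 : (1 + τ) / hbXi τ ≤ ∑ j, (m j : ℝ) := by
    by_contra hlt
    push Not at hlt
    have h1 : hbXi τ * ∑ j, ((m j : ℝ) + 1) < 1 + τ + (n + 1) * hbXi τ := by
      rw [lt_div_iff₀ hξ] at hlt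
      have : ∑ j : Fin (n + 1), ((m j : ℝ) + 1) = ∑ j, (m j : ℝ) + (n + 1) := by
        rw [sum_add_distrib, sum_const, card_univ, Fintype.card_fin, nsmul_eq_mul, mul_one]; push_cast; ring
      rw [this]; nlinarith
    have h2 : ∏ j, (Ideal.absNorm (P j) : ℝ) < X ^ (hbXi τ * ∑ j, ((m j : ℝ) + 1)) := by
      rw [rpow_sum_eq_prod_upper hX0 m]
      exact prod_lt_prod_of_nonempty (fun j _ => lt_of_lt_of_le (Real.rpow_pos_of_pos hX0 _) (hlowP j))
        (fun j _ => hhighP j) univ_nonempty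
    have h3 := Real.rpow_lt_rpow_of_exponent_lt hX h1
    rw [hNall] at nd
    linarith
  -- (3.7) via (nf)
  have h7 : ∑ j, ((m j : ℝ) + 1) ≤ (3 / 2 - τ) / hbXi τ := by
    by_contra hlt
    push Not at hlt
    have h1 : 3 / 2 - τ - (n + 1) * hbXi τ < hbXi τ * ∑ j, (m j : ℝ) := by
      rw [div_lt_iff₀ hξ] at hlt
      have : ∑ j : Fin (n + 1), ((m j : ℝ) + 1) = ∑ j, (m j : ℝ) + (n + 1) := by
        rw [sum_add_distrib, sum_const, card_univ, Fintype.card_fin, nsmul_eq_mul, mul_one]; push_cast; ring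
      rw [this] at hlt; nlinarith
    have h2 : X ^ (hbXi τ * ∑ j, (m j : ℝ)) ≤ ∏ j, (Ideal.absNorm (P j) : ℝ) := by
      rw [rpow_sum_eq_prod_lower hX0 m]
      exact prod_le_prod (fun j _ => Real.rpow_nonneg hX0.le _) fun j _ => hlowP j
    have h3 := Real.rpow_lt_rpow_of_exponent_lt hX h1
    rw [hNall] at nf
    linarith
  -- the chain constraint via (nc)
  have h15 : ∑ i : Fin n, ((m (Fin.castSucc i) : ℝ) + 1) ≤ (1 + τ) / hbXi τ := by
    rcases Nat.eq_zero_or_pos n with hn | hn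
    · subst hn; simp only [univ_eq_empty, sum_empty]; positivity
    · haveI : Nonempty (Fin n) := ⟨⟨0, hn⟩⟩
      by_contra hlt
      push Not at hlt
      have h1 : 1 + τ - n * hbXi τ < ∑ i : Fin n, (m (Fin.castSucc i) : ℝ) * hbXi τ := by
        rw [div_lt_iff₀ hξ] at hlt
        have : ∑ i : Fin n, ((m (Fin.castSucc i) : ℝ) + 1) = ∑ i : Fin n, (m (Fin.castSucc i) : ℝ) + n := by
          rw [sum_add_distrib, sum_const, card_univ, Fintype.card_fin, nsmul_eq_mul, mul_one]
        rw [this] at hlt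
        rw [← sum_mul]; nlinarith
      have h2 : X ^ (∑ i : Fin n, (m (Fin.castSucc i) : ℝ) * hbXi τ) ≤
          ∏ i : Fin n, (Ideal.absNorm (P (Fin.castSucc i)) : ℝ) := by
        rw [← prod_rpow_eq_rpow_sum hX0]
        exact prod_le_prod (fun i _ => Real.rpow_nonneg hX0.le _) fun i _ => hlowP _
      have h3 := Real.rpow_lt_rpow_of_exponent_lt hX h1
      rw [hNchain] at nc
      linarith
  -- `N(P_1) < X^{1−τ}` via (nb)
  have h16 : (m 0 : ℝ) + 1 ≤ (1 - τ) / hbXi τ := by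
    by_contra hlt
    push Not at hlt
    have h1 : 1 - τ - hbXi τ < (m 0 : ℝ) * hbXi τ := by
      rw [div_lt_iff₀ hξ] at hlt; nlinarith
    have h2 := Real.rpow_lt_rpow_of_exponent_lt hX h1
    have h3 := nb (P 0) (hPmem 0)
    linarith [hlowP 0]
  have hadm : UAdmissible τ m := ⟨⟨hanti, h5, h6, h7⟩, h15, h16⟩
  refine ⟨⟨m, P⟩, mem_sigma.mpr ⟨(mem_mIndexU_iff hτ).mpr hadm, Fintype.mem_piFinset.mpr hm⟩, ?_⟩
  simp only
  rw [himage, hPlast]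

/-- **Classification of the unmatched good indices** (contrapositive of `exists_preimage_of_good`):
a good index of `U^(n)` with `N(P_1⋯P_{n+1}) ≤ X^{3/2−τ}` that is not the chain index of an
admissible tuple falls into one of the six edge/close classes of p. 43: (a) a prime of norm
`< X^{τ+ξ}`; (b) a prime of norm `≥ X^{1−τ−ξ}`; (c) `N(P_1⋯P_n) > X^{1+τ−nξ}`; (d)
`N(P_1⋯P_{n+1}) < X^{1+τ+(n+1)ξ}`; (e) two primes with `N < N' < N·X^ξ`; (f)
`N(P_1⋯P_{n+1}) > X^{3/2−τ−(n+1)ξ}`. [cite: HeathBrownActa2001, §7 p. 43] -/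
theorem unmatched_good_cases (hX : 1 < X) (hτ : 0 < τ)
    {t : Finset (Ideal (𝓞 K)) × Ideal (𝓞 K)} (ht : t ∈ Upairs X τ n) (hg : UGood t)
    (hun : t ∉ ((mIndexU τ n).sigma (fun m => Fintype.piFinset fun i => Jprimes X τ (m i))).image
      (fun b : (Σ _ : Fin (n + 1) → ℕ, Fin (n + 1) → Ideal (𝓞 K)) =>
        ((univ : Finset (Fin n)).image (fun i => b.2 (Fin.castSucc i)), b.2 (Fin.last n)))) :
    (∃ Q ∈ insert t.2 t.1, (Ideal.absNorm Q : ℝ) < X ^ (τ + hbXi τ)) ∨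
    (∃ Q ∈ insert t.2 t.1, X ^ (1 - τ - hbXi τ) ≤ (Ideal.absNorm Q : ℝ)) ∨
    (X ^ (1 + τ - n * hbXi τ) < (Ideal.absNorm (∏ P ∈ t.1, P) : ℝ)) ∨
    ((Ideal.absNorm (uIdeal t) : ℝ) < X ^ (1 + τ + (n + 1) * hbXi τ)) ∨
    (∃ Q ∈ insert t.2 t.1, ∃ Q' ∈ insert t.2 t.1, Ideal.absNorm Q < Ideal.absNorm Q' ∧
      (Ideal.absNorm Q' : ℝ) < Ideal.absNorm Q * X ^ hbXi τ) ∨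
    (X ^ (3 / 2 - τ - (n + 1) * hbXi τ) < (Ideal.absNorm (uIdeal t) : ℝ)) := by
  classical
  by_contra h
  simp only [not_or, not_exists, not_and, not_lt, not_le] at h
  obtain ⟨na, nb, nc, nd, ne, nf⟩ := h
  obtain ⟨b, hb, hbt⟩ := exists_preimage_of_good hX hτ ht hg na nb nc nd
    (fun Q hQ Q' hQ' hlt => ne Q hQ Q' hQ' hlt) nf
  exact hun (mem_image.mpr ⟨b, hb, hbt⟩)

end SortedTuple

end Literature.NumberTheory.Sieve.CubicSieve

end


/-! ## Part C: the generic `U`-approximation inequality -/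

noncomputable section

open Polynomial NumberField Finset Filter Topology Asymptotics
open scoped nonZeroDivisors

namespace Literature.NumberTheory.Sieve.CubicSieve

open LFunctions.CubeRootTwoField CubicPrimes
open Literature.NumberTheory.LFunctions (idealNormCount)

section UGeneric

variable {ι : Type*} (E : Finset ι) (I : ι → Ideal (𝓞 K)) {X τ : ℝ} {n : ℕ}

/-- `U₁^(n)` as a sum over the filtered chain indices (the filter in the norm of `uIdeal`). [folklore] -/
theorem U1piece_eq_sum (X τ : ℝ) (n : ℕ) :
    (U1piece E I X τ n : ℝ) = ∑ t ∈ (Upairs X τ n).filter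
        (fun t => ((Ideal.absNorm (∏ P ∈ t.1, P) * Ideal.absNorm t.2 : ℕ) : ℝ) ≤ X ^ (3 / 2 - τ)),
        (famSiftedAbove E I (uIdeal t) t.2 : ℝ) := by
  classical
  rw [U1piece, UpieceWhere_eq, Nat.cast_sum]

/-- `Û^(n)` as a weighted sum over the hat index set `(𝐦, (P_i))`. [cite: HeathBrownActa2001, §3 p. 15] -/
theorem Uhat_eq_sum (X τ : ℝ) (n : ℕ) :
    Uhat X τ E I n = ∑ b ∈ (mIndexU τ n).sigma (fun m => Fintype.piFinset fun i => Jprimes X τ (m i)),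
      (∏ i, Real.log (Ideal.absNorm (b.2 i)) / ((b.1 i : ℝ) * hbXi τ * Real.log X)) *
        ∑ i ∈ E, ∑ RS ∈ divisorPairs (I i),
          if ∏ j, b.2 j = RS.2 then cCoef (X ^ ((b.1 (Fin.last n) : ℝ) * hbXi τ)) RS.1 else 0 := by
  classical
  rw [Uhat, sum_sigma]
  refine sum_congr rfl fun m _ => ?_
  rw [UhatPiece, bilin_dWeight_eq_sum_tuples]

open scoped Classical in
/-- **The generic `U`-approximation inequality, raw form** (`n ≥ 0`, any finite family of nonzero
ideals, `X > 1`, `0 < τ ≤ 1`, `1 ≤ μ ≤ τξ^{-1}`): `|U₁^(n) − Û^(n)|` is at most the sum of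
(E1) `#𝒵_{P_1⋯P_{n+1}}` over the non-good chain indices, (E2) `S_K(𝒵_{P_1⋯P_{n+1}}, X^τ)` over the
good chain indices with `N ≤ X^{3/2−τ}` that are not the index of an admissible tuple, (E3) the
Buchstab range `∑_{(𝐦,P)} ∑_{Q ≺ P_{n+1}, N(Q) ≥ X^{m_{n+1}ξ}} #{i : ∏P ∣ I_i, Q ∣ I_i, I_i rough}`,
(E4) the square-free defect `∑_{(𝐦,P)} #{i : ∏P ∣ I_i, I_i rough, N(I_i)/N(∏P) not square-free}`,
and (E5) `((1 + 1/μ)^{n+1} − 1) ∑_{(𝐦,P)} S_K(𝒵_{∏P}, X^τ)` — pp. 42–45 for `U^(n)(𝒜)`, before any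
estimation. [cite: HeathBrownActa2001, §7 pp. 42–45] -/
theorem U_abs_sub_le (hX : 1 < X) (hτ : 0 < τ) (hτ1 : τ ≤ 1) (h0 : ∀ i ∈ E, I i ≠ ⊥)
    {μ : ℕ} (hμ : 1 ≤ μ) (hμle : (μ : ℝ) ≤ τ / hbXi τ) :
    |(U1piece E I X τ n : ℝ) - Uhat X τ E I n| ≤
      ∑ t ∈ (Upairs X τ n).filter (fun t => ¬ UGood t), (famCount E I (uIdeal t) : ℝ) +
      ∑ t ∈ ((Upairs X τ n).filter
          (fun t => ((Ideal.absNorm (∏ P ∈ t.1, P) * Ideal.absNorm t.2 : ℕ) : ℝ) ≤ X ^ (3 / 2 - τ))).filter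
          (fun t => t ∉ ((mIndexU τ n).sigma (fun m => Fintype.piFinset fun i => Jprimes X τ (m i))).image
              (fun b : (Σ _ : Fin (n + 1) → ℕ, Fin (n + 1) → Ideal (𝓞 K)) =>
                ((univ : Finset (Fin n)).image (fun i => b.2 (Fin.castSucc i)), b.2 (Fin.last n))) ∧ UGood t),
        (famSifted E I (uIdeal t) (X ^ τ) : ℝ) +
      ∑ b ∈ (mIndexU τ n).sigma (fun m => Fintype.piFinset fun i => Jprimes X τ (m i)),
        ∑ Q ∈ (idealsLE (Ideal.absNorm (b.2 (Fin.last n)))).filter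
            (fun Q => Q.IsPrime ∧ Q ≠ ⊥ ∧ X ^ ((b.1 (Fin.last n) : ℝ) * hbXi τ) ≤ (Ideal.absNorm Q : ℝ) ∧
              PrimeLT Q (b.2 (Fin.last n))),
          (#{i ∈ E | (∏ j, b.2 j) ∣ I i ∧ Q ∣ I i ∧ IsRough (X ^ ((b.1 (Fin.last n) : ℝ) * hbXi τ)) (I i)} : ℝ) +
      ∑ b ∈ (mIndexU τ n).sigma (fun m => Fintype.piFinset fun i => Jprimes X τ (m i)),
        (#{i ∈ E | (∏ j, b.2 j) ∣ I i ∧ IsRough (X ^ ((b.1 (Fin.last n) : ℝ) * hbXi τ)) (I i) ∧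
            ¬ Squarefree (Ideal.absNorm (I i) / Ideal.absNorm (∏ j, b.2 j))} : ℝ) +
      ((1 + 1 / (μ : ℝ)) ^ (n + 1) - 1) *
        ∑ b ∈ (mIndexU τ n).sigma (fun m => Fintype.piFinset fun i => Jprimes X τ (m i)),
          (famSifted E I (∏ j, b.2 j) (X ^ τ) : ℝ) := by
  classical
  have hξ := hbXi_pos hτ
  have hX0 : 0 < X := by linarith
  -- abbreviations (kept syntactically identical to the statement)
  have hEx := U1piece_eq_sum E I X τ n
  have hHat := Uhat_eq_sum E I X τ n
  set R := (Upairs X τ n).filter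
    (fun t => ((Ideal.absNorm (∏ P ∈ t.1, P) * Ideal.absNorm t.2 : ℕ) : ℝ) ≤ X ^ (3 / 2 - τ)) with hR
  set A : Finset (Σ _ : Fin (n + 1) → ℕ, Fin (n + 1) → Ideal (𝓞 K)) :=
    (mIndexU τ n).sigma fun m => Fintype.piFinset fun i => Jprimes X τ (m i) with hA
  set φ : (Σ _ : Fin (n + 1) → ℕ, Fin (n + 1) → Ideal (𝓞 K)) → Finset (Ideal (𝓞 K)) × Ideal (𝓞 K) :=
    fun b => ((univ : Finset (Fin n)).image (fun i => b.2 (Fin.castSucc i)), b.2 (Fin.last n)) with hφ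
  set F : Finset (Ideal (𝓞 K)) × Ideal (𝓞 K) → ℝ := fun t => (famSiftedAbove E I (uIdeal t) t.2 : ℝ) with hF
  set G : (Σ _ : Fin (n + 1) → ℕ, Fin (n + 1) → Ideal (𝓞 K)) → ℝ := fun b =>
    ∑ i ∈ E, ∑ RS ∈ divisorPairs (I i),
      if ∏ j, b.2 j = RS.2 then cCoef (X ^ ((b.1 (Fin.last n) : ℝ) * hbXi τ)) RS.1 else 0 with hG
  set G₁ : (Σ _ : Fin (n + 1) → ℕ, Fin (n + 1) → Ideal (𝓞 K)) → ℝ := fun b =>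
    (famSifted E I (∏ j, b.2 j) (X ^ ((b.1 (Fin.last n) : ℝ) * hbXi τ)) : ℝ) with hG₁
  set wt : (Σ _ : Fin (n + 1) → ℕ, Fin (n + 1) → Ideal (𝓞 K)) → ℝ := fun b =>
    ∏ i, Real.log (Ideal.absNorm (b.2 i)) / ((b.1 i : ℝ) * hbXi τ * Real.log X) with hwt
  -- properties of the hat indices
  have hprops : ∀ b ∈ A, UAdmissible τ b.1 ∧
      (∀ j, (b.2 j).IsPrime ∧ b.2 j ≠ ⊥ ∧ (Ideal.absNorm (b.2 j)).Prime ∧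
        X ^ ((b.1 j : ℝ) * hbXi τ) ≤ (Ideal.absNorm (b.2 j) : ℝ) ∧
        (Ideal.absNorm (b.2 j) : ℝ) < X ^ (((b.1 j : ℝ) + 1) * hbXi τ)) ∧
      (∀ j, b.2 j ∈ smallPrimes X τ) ∧
      (StrictAnti fun j => Ideal.absNorm (b.2 j)) ∧
      (∀ j, X ^ ((b.1 (Fin.last n) : ℝ) * hbXi τ) ≤ (Ideal.absNorm (b.2 j) : ℝ)) ∧
      X ^ (1 + τ) ≤ ∏ j, (Ideal.absNorm (b.2 j) : ℝ) ∧
      ∏ j, (Ideal.absNorm (b.2 j) : ℝ) < X ^ (3 / 2 - τ) ∧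
      ∏ i : Fin n, (Ideal.absNorm (b.2 (Fin.castSucc i)) : ℝ) < X ^ (1 + τ) ∧
      (∀ j, 1 ≤ b.1 j) ∧ X ^ τ ≤ X ^ ((b.1 (Fin.last n) : ℝ) * hbXi τ) := by
    rintro ⟨m, P⟩ hb
    rw [hA, mem_sigma] at hb
    exact U_index_props hX hτ hτ1 hb.1 hb.2
  have hpair : ∀ b ∈ A, φ b ∈ Upairs X τ n ∧ uIdeal (φ b) = ∏ j, b.2 j ∧
      (Ideal.absNorm (∏ j, b.2 j) : ℝ) < X ^ (3 / 2 - τ) ∧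
      X ^ (1 + τ) ≤ (Ideal.absNorm (∏ j, b.2 j) : ℝ) := by
    rintro ⟨m, P⟩ hb
    rw [hA, mem_sigma] at hb
    exact toPair_mem hX hτ hτ1 hb.1 hb.2
  have hrough : ∀ b ∈ A, IsRough (X ^ ((b.1 (Fin.last n) : ℝ) * hbXi τ)) (∏ j, b.2 j) := by
    intro b hb
    obtain ⟨-, hJ, -, -, hzle, -⟩ := hprops b hb
    exact isRough_prod_of_le (fun j => ⟨(hJ j).1, (hJ j).2.1⟩) hzle
  have hφR : ∀ b ∈ A, φ b ∈ R := by
    intro b hb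
    obtain ⟨hU, hu, hlt, -⟩ := hpair b hb
    rw [hR, mem_filter]
    refine ⟨hU, ?_⟩
    rw [← map_mul, ← uIdeal, hu]
    exact hlt.le
  have hinj : Set.InjOn φ A := toPair_injOn hX hτ hτ1
  have huφ : ∀ b ∈ A, uIdeal (φ b) = ∏ j, b.2 j := fun b hb => (hpair b hb).2.1
  -- matching
  have hmatch := abs_sub_le_of_matching R A F G G₁ wt φ hφR hinj
    (fun t _ => Nat.cast_nonneg _)
    (fun b hb => hatCount_nonneg E I (fun R' => by
        rcases cCoef_eq_zero_or_one (X ^ ((b.1 (Fin.last n) : ℝ) * hbXi τ)) R' with h | h <;> simp [h]) _)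
    (fun b hb => hatCount_le_famSifted E I h0 _ (hrough b hb))
    (fun b hb => by
      obtain ⟨-, -, -, -, hzle, -⟩ := hprops b hb
      have h := famSiftedAbove_le_famSifted E I (∏ j, b.2 j) (b.2 (Fin.last n)) (hzle (Fin.last n))
      have h' : (famSiftedAbove E I (uIdeal (φ b)) (b.2 (Fin.last n)) : ℝ) ≤
          famSifted E I (∏ j, b.2 j) (X ^ ((b.1 (Fin.last n) : ℝ) * hbXi τ)) := by
        rw [huφ b hb]; exact_mod_cast h
      simpa only [hF, hG₁, hφ] using h')
    (fun b hb => by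
      obtain ⟨hadm, -⟩ := hprops b hb
      have hb' := hb; rw [hA, mem_sigma] at hb'
      have hμm : ∀ i, μ ≤ b.1 i := fun i => by
        have := hadm.1.2.1 i
        exact_mod_cast hμle.trans this
      have h := (tupleWt_bounds hX hτ hμ hμm hb'.2).1
      simpa only [hwt] using h)
  rw [hEx, hHat]
  refine hmatch.trans ?_
  -- (E1) + (E2): unmatched terms, split by goodness
  have hun : ∑ t ∈ R.filter (fun t => t ∉ A.image φ), F t ≤
      ∑ t ∈ (Upairs X τ n).filter (fun t => ¬ UGood t), (famCount E I (uIdeal t) : ℝ) +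
      ∑ t ∈ R.filter (fun t => t ∉ A.image φ ∧ UGood t), (famSifted E I (uIdeal t) (X ^ τ) : ℝ) := by
    have hpt : ∀ t ∈ R.filter (fun t => t ∉ A.image φ), F t ≤
        (if ¬ UGood t then (famCount E I (uIdeal t) : ℝ) else 0) +
        (if UGood t then (famSifted E I (uIdeal t) (X ^ τ) : ℝ) else 0) := by
      intro t ht
      have htU := (mem_filter.mp (mem_filter.mp ht).1).1
      by_cases hg : UGood t
      · have h2 := (mem_smallPrimes_iff.mp (mem_Upairs_iff.mp htU).2.1).2.2.1
        simp only [hg, not_true_eq_false, if_false, if_true, zero_add, hF]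
        exact_mod_cast famSiftedAbove_le_famSifted E I _ _ h2
      · simp only [hg, not_false_eq_true, if_true, if_false, add_zero, hF]
        exact_mod_cast famSiftedAbove_le_famCount E I _ _
    calc ∑ t ∈ R.filter (fun t => t ∉ A.image φ), F t
        ≤ ∑ t ∈ R.filter (fun t => t ∉ A.image φ),
            ((if ¬ UGood t then (famCount E I (uIdeal t) : ℝ) else 0) +
              (if UGood t then (famSifted E I (uIdeal t) (X ^ τ) : ℝ) else 0)) := sum_le_sum hpt
      _ = ∑ t ∈ (R.filter (fun t => t ∉ A.image φ)).filter (fun t => ¬ UGood t), (famCount E I (uIdeal t) : ℝ) +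
          ∑ t ∈ (R.filter (fun t => t ∉ A.image φ)).filter (fun t => UGood t),
            (famSifted E I (uIdeal t) (X ^ τ) : ℝ) := by
          rw [sum_add_distrib]
          congr 1
          · exact (sum_filter (fun t => ¬ UGood t) _).symm
          · exact (sum_filter (fun t => UGood t) _).symm
      _ ≤ _ := by
          refine add_le_add ?_ ?_
          · refine sum_le_sum_of_subset_of_nonneg (fun t ht => ?_) fun _ _ _ => Nat.cast_nonneg _
            have ht1 := (mem_filter.mp ht).1
            have ht2 := (mem_filter.mp ht).2
            exact mem_filter.mpr ⟨(mem_filter.mp (mem_filter.mp ht1).1).1, ht2⟩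
          · refine sum_le_sum_of_subset_of_nonneg (fun t ht => ?_) fun _ _ _ => Nat.cast_nonneg _
            have ht1 := (mem_filter.mp ht).1
            have ht2 := (mem_filter.mp ht).2
            exact mem_filter.mpr ⟨(mem_filter.mp ht1).1, (mem_filter.mp ht1).2, ht2⟩
  -- (E3): Buchstab
  have hbuch : ∑ b ∈ A, (G₁ b - F (φ b)) ≤
      ∑ b ∈ A, ∑ Q ∈ (idealsLE (Ideal.absNorm (b.2 (Fin.last n)))).filter
          (fun Q => Q.IsPrime ∧ Q ≠ ⊥ ∧ X ^ ((b.1 (Fin.last n) : ℝ) * hbXi τ) ≤ (Ideal.absNorm Q : ℝ) ∧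
            PrimeLT Q (b.2 (Fin.last n))),
        (#{i ∈ E | (∏ j, b.2 j) ∣ I i ∧ Q ∣ I i ∧ IsRough (X ^ ((b.1 (Fin.last n) : ℝ) * hbXi τ)) (I i)} : ℝ) := by
    refine sum_le_sum fun b hb => ?_
    have h := famSifted_sub_famSiftedAbove_le E I h0 (∏ j, b.2 j) (b.2 (Fin.last n))
      (X ^ ((b.1 (Fin.last n) : ℝ) * hbXi τ))
    have h' : G₁ b - (famSiftedAbove E I (uIdeal (φ b)) (b.2 (Fin.last n)) : ℝ) ≤
        ∑ Q ∈ (idealsLE (Ideal.absNorm (b.2 (Fin.last n)))).filter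
          (fun Q => Q.IsPrime ∧ Q ≠ ⊥ ∧ X ^ ((b.1 (Fin.last n) : ℝ) * hbXi τ) ≤ (Ideal.absNorm Q : ℝ) ∧
            PrimeLT Q (b.2 (Fin.last n))),
        (#{i ∈ E | (∏ j, b.2 j) ∣ I i ∧ Q ∣ I i ∧ IsRough (X ^ ((b.1 (Fin.last n) : ℝ) * hbXi τ)) (I i)} : ℝ) := by
      rw [huφ b hb]; simpa only [hG₁] using h
    simpa only [hF, hφ] using h'
  -- (E4): square-free defect
  have hsq : ∑ b ∈ A, (G₁ b - G b) =
      ∑ b ∈ A, (#{i ∈ E | (∏ j, b.2 j) ∣ I i ∧ IsRough (X ^ ((b.1 (Fin.last n) : ℝ) * hbXi τ)) (I i) ∧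
          ¬ Squarefree (Ideal.absNorm (I i) / Ideal.absNorm (∏ j, b.2 j))} : ℝ) := by
    refine sum_congr rfl fun b hb => ?_
    exact famSifted_sub_hatCount_eq E I h0 _ (hrough b hb)
  -- (E5): weight
  have hwt_le : ∑ b ∈ A, (wt b - 1) * G₁ b ≤
      ((1 + 1 / (μ : ℝ)) ^ (n + 1) - 1) * ∑ b ∈ A, (famSifted E I (∏ j, b.2 j) (X ^ τ) : ℝ) := by
    rw [mul_sum]
    refine sum_le_sum fun b hb => ?_
    obtain ⟨hadm, -, -, -, -, -, -, -, -, hτz⟩ := hprops b hb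
    have hb' := hb; rw [hA, mem_sigma] at hb'
    have hwb := tupleWt_bounds hX hτ hμ (fun i => by
      have := hadm.1.2.1 i; exact_mod_cast hμle.trans this) hb'.2
    have hG₁le : G₁ b ≤ famSifted E I (∏ j, b.2 j) (X ^ τ) := by
      simp only [hG₁]; exact_mod_cast famSifted_antitone E I hτz
    have hG₁0 : 0 ≤ G₁ b := by simp only [hG₁]; exact Nat.cast_nonneg _
    have h1 : wt b - 1 ≤ (1 + 1 / (μ : ℝ)) ^ (n + 1) - 1 := by
      have := hwb.2; simp only [hwt]; linarith
    have h0' : 0 ≤ wt b - 1 := by have := hwb.1; simp only [hwt]; linarith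
    calc (wt b - 1) * G₁ b ≤ ((1 + 1 / (μ : ℝ)) ^ (n + 1) - 1) * G₁ b :=
          mul_le_mul_of_nonneg_right h1 hG₁0
      _ ≤ ((1 + 1 / (μ : ℝ)) ^ (n + 1) - 1) * famSifted E I (∏ j, b.2 j) (X ^ τ) :=
          mul_le_mul_of_nonneg_left hG₁le (h0'.trans h1)
  -- assemble
  have hsplit : ∑ b ∈ A, ((G₁ b - F (φ b)) + (G₁ b - G b) + (wt b - 1) * G₁ b) =
      ∑ b ∈ A, (G₁ b - F (φ b)) + ∑ b ∈ A, (G₁ b - G b) + ∑ b ∈ A, (wt b - 1) * G₁ b := by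
    rw [sum_add_distrib, sum_add_distrib]
  rw [hsplit, hsq]
  linarith [hun, hbuch, hwt_le]

open scoped Classical in
/-- **(E2) classified**: the unmatched good chain indices with `N ≤ X^{3/2−τ}` lie in the six
edge/close classes (`unmatched_good_cases`), so their sum of sifting functions is at most the sum
over the classes. [cite: HeathBrownActa2001, §7 p. 43] -/
theorem sum_unmatched_good_le (hX : 1 < X) (hτ : 0 < τ) (f : Finset (Ideal (𝓞 K)) × Ideal (𝓞 K) → ℝ)
    (hf : ∀ t, 0 ≤ f t) :
    ∑ t ∈ ((Upairs X τ n).filter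
        (fun t => ((Ideal.absNorm (∏ P ∈ t.1, P) * Ideal.absNorm t.2 : ℕ) : ℝ) ≤ X ^ (3 / 2 - τ))).filter
        (fun t => t ∉ ((mIndexU τ n).sigma (fun m => Fintype.piFinset fun i => Jprimes X τ (m i))).image
            (fun b : (Σ _ : Fin (n + 1) → ℕ, Fin (n + 1) → Ideal (𝓞 K)) =>
              ((univ : Finset (Fin n)).image (fun i => b.2 (Fin.castSucc i)), b.2 (Fin.last n))) ∧ UGood t),
        f t ≤
      ∑ t ∈ (Upairs X τ n).filter (fun t => UGood t ∧
          (Ideal.absNorm (uIdeal t) : ℝ) ≤ X ^ (3 / 2 - τ) ∧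
          ((∃ Q ∈ insert t.2 t.1, (Ideal.absNorm Q : ℝ) < X ^ (τ + hbXi τ)) ∨
           (∃ Q ∈ insert t.2 t.1, X ^ (1 - τ - hbXi τ) ≤ (Ideal.absNorm Q : ℝ)) ∨
           (X ^ (1 + τ - n * hbXi τ) < (Ideal.absNorm (∏ P ∈ t.1, P) : ℝ)) ∨
           ((Ideal.absNorm (uIdeal t) : ℝ) < X ^ (1 + τ + (n + 1) * hbXi τ)) ∨
           (∃ Q ∈ insert t.2 t.1, ∃ Q' ∈ insert t.2 t.1, Ideal.absNorm Q < Ideal.absNorm Q' ∧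
              (Ideal.absNorm Q' : ℝ) < Ideal.absNorm Q * X ^ hbXi τ) ∨
           (X ^ (3 / 2 - τ - (n + 1) * hbXi τ) < (Ideal.absNorm (uIdeal t) : ℝ)))), f t := by
  classical
  refine sum_le_sum_of_subset_of_nonneg (fun t ht => ?_) fun _ _ _ => hf _
  have ht1 := (mem_filter.mp ht).1
  obtain ⟨hun, hg⟩ := (mem_filter.mp ht).2
  obtain ⟨htU, hle⟩ := mem_filter.mp ht1
  refine mem_filter.mpr ⟨htU, hg, ?_, unmatched_good_cases hX hτ htU hg hun⟩
  rw [absNorm_uIdeal]; exact_mod_cast hle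

end UGeneric

end Literature.NumberTheory.Sieve.CubicSieve

end
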